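import Literature.NumberTheory.LFunctions.Zhang2022.MainTermFormCauchySchwarz
import Literature.NumberTheory.LFunctions.Zhang2022.KnifeEdgeLenZDegreeShortPolyDense
import Summits.Parity.GeneralizedHardyLittlewood.Theorems.PsiGradedTablesClosePoly.Negative.SubUnitTwistThreshold
import HarnessLib

/-!
# Negative lane of `PsiGradedTablesClosePoly` (h2′): the threshold SCALE of the sub-unit POLYNOMIAL class is `≤ 0.3388`
# — `𝔅` is continuous in `𝔅`-distance, so poly pieces of length `9/10` come with `𝔅 < 0.3388 + ε`

Y. Zhang, *Discrete mean estimates and the Landau–Siegel zero*, arXiv:2211.02515v1 [Zhang2022LandauSiegel] — an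
unrefereed manuscript under adjudication; nothing here asserts any of its claims and nothing here is a statement about
Landau–Siegel zeros. Desk lemma of the §G referee (ls-ref-1; F1-THRESHOLD v1.1), (A)-free:

* `mainTermForm_le_of_sub_le` — VALUE CONTINUITY of the diagonal main-term form in `𝔅`-distance (polarisation +
  Cauchy–Schwarz of `MainTermFormCauchySchwarz`): for `H¹` profiles `u, p` with `𝔅(u − p) ≤ η`,
  `𝔅(p) ≤ 𝔅(u) + 2√(𝔅(u)·η) + η`;
* **`exists_polyShortPiece_nine_tenths_lt`** — for every `ε > 0` there is a POLYNOMIAL short piece `p` of length `9/10`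
  (`PolyShortPiece (9/10) p p'`, hence a leg of h2′'s class `SubUnitPolyPairs` / `𝒞_{poly<1}`) with `𝔅(p) < 0.3388 + ε`
  (density `ShortPiece.exists_polyShortPiece_approx` at the twisted piece `ϰ_{9/10,17/10}` + the kernel bracket
  `SubUnitTwistThreshold.mainTermForm_kappaP_nine_tenths`);
* `exists_subUnitPoly_design_lt` — the same packaged as h2′'s class token: `∃ p p', (∃ θ < 1, PolyShortPiece θ p p') ∧
  InClassPiece p p' ∧ 𝔅(p) < 0.3388 + ε`.

So the one-cell closing threshold `‖X(f,g)‖ > √(𝔅(f)𝔅(g))` ON the sub-unit poly class gets as low as `0.3388 + ε` at poly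
designs (and no lower than what the class's `inf 𝔅` allows — not computed here). No Theses statement asserted; no new
`Prop`; axioms standard.
-/

noncomputable section

open Complex Real ComplexConjugate

namespace Summit.Parity.GeneralizedHardyLittlewood.Theorems.PsiGradedTablesClosePoly.Negative

open Literature.NumberTheory.LFunctions.Zhang2022 Literature.NumberTheory.LFunctions.Zhang2022.KnifeEdge
open Literature.NumberTheory.LFunctions.Zhang2022.Repair

/-! ### Part 1 — value continuity of `𝔅` in `𝔅`-distance -/

/-- **`𝔅(p) ≤ 𝔅(u) + 2√(𝔅(u)η) + η` whenever `𝔅(u − p) ≤ η`** (`u, p ∈ H¹`): polarisation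
`𝔅(u − w) = 𝔅(u) − 2Re P(u,w) + 𝔅(w)` with `w = u − p` and Cauchy–Schwarz `|P(u,w)|² ≤ 𝔅(u)𝔅(w)`. [folklore] -/
theorem mainTermForm_le_of_sub_le {u u' p p' : ℝ → ℂ} (hu : IsH1OnUnitInterval u u') (hp : IsH1OnUnitInterval p p')
    {η : ℝ} (hw : mainTermForm (fun x => u x - p x) (fun x => u' x - p' x) ≤ η) :
    mainTermForm p p' ≤ mainTermForm u u' + 2 * Real.sqrt (mainTermForm u u' * η) + η := by
  set w : ℝ → ℂ := fun x => u x - p x with hw_def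
  set w' : ℝ → ℂ := fun x => u' x - p' x with hw'_def
  have hwH1 : IsH1OnUnitInterval w w' := by
    have h := hu.add_smul hp (-1)
    convert h using 1 <;> funext x <;> simp [w, w'] <;> ring
  have hBu := mainTermForm_nonneg_of_isH1 hu
  have hBw := mainTermForm_nonneg_of_isH1 hwH1
  have hpeq : mainTermForm p p' = mainTermForm (fun x => u x + (-1) * w x) (fun x => u' x + (-1) * w' x) := by
    congr 1 <;> funext x <;> simp [w, w']
  rw [hpeq, mainTermForm_add_smul hu hwH1 (-1)]
  have hP := norm_mainTermFormPolar_le_sqrt hu hwH1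
  have hre : (conj (-1 : ℂ) * mainTermFormPolar u u' w w').re ≤ ‖mainTermFormPolar u u' w w'‖ := by
    have h1 := Complex.re_le_norm (conj (-1 : ℂ) * mainTermFormPolar u u' w w')
    simpa using h1
  have hsqrt : Real.sqrt (mainTermForm u u' * mainTermForm w w') ≤ Real.sqrt (mainTermForm u u' * η) :=
    Real.sqrt_le_sqrt (mul_le_mul_of_nonneg_left hw hBu)
  have hn : ‖(-1 : ℂ)‖ ^ 2 = 1 := by simp
  rw [hn]
  linarith

/-! ### Part 2 — polynomial pieces of length `9/10` with `𝔅 < 0.3388 + ε` -/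

/-- **For every `ε > 0` there is a polynomial short piece `p` of length `9/10` with `𝔅(p) < 0.3388 + ε`** (poly density
at the twisted piece `ϰ_{9/10,17/10}`, whose form is `< 0.3388` in kernel). [cite: Zhang2022LandauSiegel, §7 (7.2) p.13, (2.23)–(2.25) p.9] -/
theorem exists_polyShortPiece_nine_tenths_lt {ε : ℝ} (hε : 0 < ε) :
    ∃ p p' : ℝ → ℂ, PolyShortPiece (9/10) p p' ∧ mainTermForm p p' < 0.3388 + ε := by
  set η : ℝ := min (ε / 2) (ε ^ 2 / 8) with hη_def
  have hη : 0 < η := lt_min (by linarith) (by positivity)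
  have hη1 : η ≤ ε / 2 := min_le_left _ _
  have hη2 : η ≤ ε ^ 2 / 8 := min_le_right _ _
  have hκs := shortPiece_kappaP (ν := 9/10) (by norm_num) (by norm_num) (17/10)
  obtain ⟨p, p', hpoly, hclose⟩ := hκs.exists_polyShortPiece_approx (by norm_num) hη
  refine ⟨p, p', hpoly, ?_⟩
  have hu : IsH1OnUnitInterval (kappaP (9/10) (17/10)) (kappaP' (9/10) (17/10)) :=
    (kinkedProfile_kappaP (ν := 9/10) (k := 17/10) (by norm_num) (by norm_num)).isH1
  have hpH1 : IsH1OnUnitInterval p p' := hpoly.inClassPiece.kinked.isH1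
  have hle := mainTermForm_le_of_sub_le hu hpH1 hclose
  have hB := mainTermForm_kappaP_nine_tenths
  have hBnn : 0 ≤ mainTermForm (kappaP (9/10) (17/10)) (kappaP' (9/10) (17/10)) := by linarith [hB.1]
  -- `√(𝔅(κ)·η) ≤ ε/4` since `𝔅(κ)·η ≤ 0.3388·ε²/8 ≤ (ε/4)²`
  have hprod : mainTermForm (kappaP (9/10) (17/10)) (kappaP' (9/10) (17/10)) * η ≤ (ε / 4) ^ 2 := by
    nlinarith [mul_le_mul hB.2.le hη2 hη.le (by norm_num : (0:ℝ) ≤ 0.3388)]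
  have hsq : Real.sqrt (mainTermForm (kappaP (9/10) (17/10)) (kappaP' (9/10) (17/10)) * η) ≤ ε / 4 := by
    calc Real.sqrt (mainTermForm (kappaP (9/10) (17/10)) (kappaP' (9/10) (17/10)) * η)
        ≤ Real.sqrt ((ε / 4) ^ 2) := Real.sqrt_le_sqrt hprod
      _ = ε / 4 := Real.sqrt_sq (by linarith)
  linarith [hB.2]

/-- The same packaged in h2′'s class token: a sub-unit polynomial in-class design with `𝔅 < 0.3388 + ε`.
[cite: Zhang2022LandauSiegel, §7 (7.2) p.13, (2.23)–(2.25) p.9] -/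
theorem exists_subUnitPoly_design_lt {ε : ℝ} (hε : 0 < ε) :
    ∃ p p' : ℝ → ℂ, (∃ θ : ℝ, θ < 1 ∧ PolyShortPiece θ p p') ∧ InClassPiece p p' ∧ mainTermForm p p' < 0.3388 + ε := by
  obtain ⟨p, p', hpoly, hlt⟩ := exists_polyShortPiece_nine_tenths_lt hε
  exact ⟨p, p', ⟨9/10, by norm_num, hpoly⟩, hpoly.inClassPiece, hlt⟩

end Summit.Parity.GeneralizedHardyLittlewood.Theorems.PsiGradedTablesClosePoly.Negative

end
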